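import Summits.RiemannHypothesis.RiemannHypothesis.Theorems.SoloInformedGroundStateZeroSide
import Literature.NumberTheory.LFunctions.UniformWeilPositivityRH
import Literature.NumberTheory.LFunctions.ExplicitFormulaPsi
import HarnessLib

/-!
# The logical status of «domination laws» for Weil's form (the prolate domination conjecture placed)

TRACK «HANDOFF», seat handoff-theory-1 (H-T, statement owner), file XXI: the custody placement of
the idea-1 lens's conjecture **(PL) PROLATE DOMINATION** (`HOME/handoff/IDEAS-prolate.md` PART XVIII
§99–§100; typed HOME-only in `handoff/idea-1/g22/lean/HandoffProlateDomination.lean` as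
`ProlateDominationWith κ A λ₀ := ∀ λ ≥ λ₀, ∀ g, IsWeilTest g → tsupport g ⊆ [-log λ, log λ] →
κ·λ^{-A}·L_λ(g) ≤ Re Q(g)`, `L_λ(g) ≥ 0` the prolate leakage of the `ℰ`-preimages of `g`).
Sorry-free, standard axioms, no definitions, no new analysis — bookkeeping on tree theorems
(`explicit_formula_holds`, the unconditional Bessel bound `norm_weilZeroSidePartial_weilQuadratic_le`,
`riemannHypothesis_iff_forall_weilPositivityOn`).  Companion file XXI-b `HandoffDominationFloor.lean`:
the scalar shadow of a domination law and its RH-free ceiling (slope `2` of file XVII's table).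

A WINDOW DOMINATION LAW is any sentence of the shape

  `DOM(Φ, λ₀) :  ∀ λ ≥ λ₀, ∀ g (Weil test, tsupport g ⊆ [-log λ, log λ]),  Φ λ g ≤ Re Q(g)`

with a comparison functional `Φ ≥ 0` on the windows it speaks about ((PL): `Φ λ g = κλ^{-A}L_λ(g)`;
a margin law: `Φ λ g = m(λ)‖g‖₂²`).  Its ZERO-SIDE form replaces `Re Q(g)` by the zero-side energy
`Z(g) = sup_T Σ_{|Im ρ| ≤ T} m(ρ)‖ĝ(ρ)‖²` (non-trivial zeros of `ζ` WHEREVER THEY LIE, with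
multiplicity; `ĝ = weilMellin g`), written junk-free through the truncations
`S_T(g) = Σᶠ_{ρ ∈ weilZeroIndex T} m(ρ)‖ĝ(ρ)‖²`, which increase with `T`:

  `DOM_Z(Φ, λ₀) : ∀ λ ≥ λ₀, ∀ g (…), ∀ ε > 0, ∃ T, Φ λ g ≤ S_T(g) + ε`.

* §1 (RH-free) `exists_le_zeroSum_add_of_le_re_weilQuadratic`: `x ≤ Re Q(g) ⟹ ∀ ε > 0 ∃ T, x ≤ S_T(g) + ε`
  — Weil's explicit formula and `2|ab| ≤ |a|² + |b|²` (tree); `zeroSum_mono`: `T ↦ S_T(g)` is monotone.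
* §2 (under RH) `zeroSum_le_re_weilQuadratic_of_riemannHypothesis`: `S_T(g) ≤ Re Q(g)` for every `T`
  (on the line `(g ⋆ g̃)^(ρ) = ‖ĝ(ρ)‖²`, so the truncated zero sides ARE the `S_T`, a monotone family
  converging to `Q(g)`) — the finite pinning inequality of theory-2's file XII-w for the index sets
  `weilZeroIndex T`, re-derived from `explicit_formula_holds`; hence
  `le_re_weilQuadratic_iff_of_riemannHypothesis`: under RH, `x ≤ Re Q(g) ↔ ∀ ε > 0 ∃ T, x ≤ S_T(g) + ε`.
* §3 **THE STATUS THEOREM** `windowDomination_iff`: for `Φ ≥ 0` (any `λ₀`),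
  **`DOM(Φ, λ₀) ⟺ RH ∧ DOM_Z(Φ, λ₀)`**; the three arrows separately: `riemannHypothesis_of_windowDomination`
  (idea-1's `(PL) → RH`, in which `Φ` is idle: only `Φ ≥ 0` is used),
  `zeroSideDomination_of_windowDomination` (RH-free), `windowDomination_of_riemannHypothesis`.
* (file XXI-b, §4) THE SCALAR SHADOW AND ITS RH-FREE CEILING: a floor `φ(λ)‖g‖₂² ≤ Φ λ g` turns `DOM`
  into the lower size law `φ(λ) ≤ ε(log λ)`; no window law with floor `exp(-C λ^s)`, `s < 2`, holds
  (RH-free, from `weilGroundEnergy_exp_exp_decay`); a Gaussian-in-`λ` floor puts the law at slope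
  EXACTLY `2` of file XVII's table (`RH ∧ bare(2)`).

READING for (PL) (LOGIC-CARD item 4⁗″; instantiate `Φ λ g := κ * λ ^ (-A) * prolateLeakage λ g`):
**(PL) ⟺ RH ∧ (PL_Z)**, where (PL_Z) := `DOM_Z` of the same functional — «the ZERO-SIDE energy of a
window test dominates the prolate leakage of its `ℰ`-preimages» — is RH-FREE (it quantifies over the
zeros wherever they are and is not trivialised in a `¬RH` world, where `Z ≥ Re Q` only grows), is
implied by (PL), and is (PL)'s ENTIRE content beyond RH.  So (PL) is not a door: a proof of (PL) is a
proof of RH and of (PL_Z), and (PL_Z) by itself is silent on RH.  What the cell MEASURES tests (PL_Z):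
idea-1's F1 constant `κ*(λ) = min_g Re Q/L_λ` over a section bounds `min_g Z/L_λ` from below (§1), so
the two-lineage staircase `κ* = 0.372 / 0.320 / 0.300 / 0.205 / 0.149` (λ² = 3 … 23; RH-PROMISE §4
row 114, DATA, labels theirs) CONFIRMS (PL_Z) on those sections, and the never-run dodger test F4 would
attack (PL_Z) RH-free (prove-2's zero-dodgers have small `Z` by construction).  With idea-1's leakage
floor `L_λ(g) ≥ (1 − λ₀(2πλ²))‖g‖²/(4λ²)` (§100.1, DERIVED) and Slepian's `1 − λ₀(c) ≍ √c·e^{-2c}`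
(Fuchs 1964, print), (PL) carries a Gaussian floor `κ'λ^{-B}e^{-4πλ²}`: by XXI-b it sits at slope EXACTLY
`2` — `≥ RH`; refuting it RH-free needs a decay rate `c > 4π` in `weilGroundEnergy_exp_exp_decay`, i.e.
a window direction below the Slepian floor; deriving it from RH needs a slope-`2` lower size law, which
the tree's RH-world law (slope `A`) does not give.  Nothing here bears on the truth of RH.
-/

noncomputable section

set_option linter.dupNamespace false  -- the mandated namespace repeats `RiemannHypothesis`

open Filter Topology Set Complex Literature.NumberTheory.LFunctions
open scoped ComplexConjugate

namespace Summit.RiemannHypothesis.RiemannHypothesis.Theorems.HandoffDomination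

open Summit.RiemannHypothesis.RiemannHypothesis.Theorems

/-! ## §1  The zero-side energy majorises Weil's form — no Riemann hypothesis -/

section ZeroSide

variable {g : ℝ → ℂ}

/-- Every term of the truncated zero-side energy `S_T(g) = Σ_{|Im ρ| ≤ T} m(ρ)‖ĝ(ρ)‖²` is `≥ 0`
(`m(ρ) ≥ 0` off the pole, `riemannZetaZeroOrder_nonneg`; the indices are `≠ 1`,
`ne_one_of_mem_weilZeroIndex`). -/
theorem zeroSum_term_nonneg {T : ℝ} {ρ : ℂ} (h : ρ ∈ weilZeroIndex T) :
    0 ≤ (riemannZetaZeroOrder ρ : ℝ) * ‖weilMellin g ρ‖ ^ 2 :=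
  mul_nonneg (by exact_mod_cast riemannZetaZeroOrder_nonneg (ne_one_of_mem_weilZeroIndex h))
    (by positivity)

/-- The truncated zero-side energy is `≥ 0`. -/
theorem zeroSum_nonneg (g : ℝ → ℂ) (T : ℝ) :
    0 ≤ ∑ᶠ ρ ∈ weilZeroIndex T, (riemannZetaZeroOrder ρ : ℝ) * ‖weilMellin g ρ‖ ^ 2 :=
  finsum_mem_induction (fun x : ℝ ↦ 0 ≤ x) (le_refl _) (fun _ _ hx hy ↦ add_nonneg hx hy)
    fun _ hρ ↦ zeroSum_term_nonneg hρ

/-- **The truncations are monotone in the height**: `T ≤ T' ⟹ S_T(g) ≤ S_{T'}(g)` (the index sets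
increase and the terms are non-negative).  So `Z(g) := sup_T S_T(g) ∈ [0, ∞]` is an honest supremum,
and «`x ≤ S_T(g) + ε` for some `T`» reads «`x ≤ Z(g) + ε`». -/
theorem zeroSum_mono (g : ℝ → ℂ) :
    Monotone fun T : ℝ ↦
      ∑ᶠ ρ ∈ weilZeroIndex T, (riemannZetaZeroOrder ρ : ℝ) * ‖weilMellin g ρ‖ ^ 2 := by
  intro T T' hTT'
  have hfin := weilZeroIndex_finite T
  have hfin' := weilZeroIndex_finite T'
  have hsub : weilZeroIndex T ⊆ weilZeroIndex T' :=
    fun ρ ⟨h0, h1, h2, h3, h4⟩ ↦ ⟨h0, h1, h2, h3, h4.trans hTT'⟩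
  dsimp only
  rw [finsum_mem_eq_finite_toFinset_sum _ hfin, finsum_mem_eq_finite_toFinset_sum _ hfin']
  refine Finset.sum_le_sum_of_subset_of_nonneg
    (Set.Finite.toFinset_subset_toFinset.2 hsub) fun ρ hρ _ ↦ ?_
  exact zeroSum_term_nonneg (hfin'.mem_toFinset.1 hρ)

/-- **`Re Q(g) ≤ Z(g)`, unconditionally.**  If `x ≤ Re Q(g)` then for every `ε > 0` some truncated
zero-side energy exceeds `x − ε`: `∃ T, x ≤ S_T(g) + ε`.  (Weil's explicit formula
`explicit_formula_holds` makes `Q(g)` the limit of the truncated zero sides of `g ⋆ g̃`, each of which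
is bounded in modulus by `S_T(g)` — the tree's RH-free Bessel bound
`norm_weilZeroSidePartial_weilQuadratic_le`, from `(g ⋆ g̃)^(ρ) = ĝ(ρ)·conj ĝ(1−ρ̄)`,
`2|ab| ≤ |a|² + |b|²` and the symmetry `ρ ↦ 1 − ρ̄` of the zeros.)  No hypothesis on the zeros. -/
theorem exists_le_zeroSum_add_of_le_re_weilQuadratic (hg : IsWeilTest g) {x : ℝ}
    (hx : x ≤ (weilQuadratic g).re) {ε : ℝ} (hε : 0 < ε) :
    ∃ T : ℝ, x ≤
      (∑ᶠ ρ ∈ weilZeroIndex T, (riemannZetaZeroOrder ρ : ℝ) * ‖weilMellin g ρ‖ ^ 2) + ε := by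
  have hk : IsWeilTest (weilConv g (weilReflect g)) := hg.weilConv hg.weilReflect
  have hlim : Tendsto (fun T ↦ ‖weilZeroSidePartial (weilConv g (weilReflect g)) T‖) atTop
      (𝓝 ‖weilQuadratic g‖) :=
    (continuous_norm.tendsto _).comp (explicit_formula_holds hk)
  have hev : ∀ᶠ T in atTop,
      ‖weilQuadratic g‖ - ε < ‖weilZeroSidePartial (weilConv g (weilReflect g)) T‖ :=
    (tendsto_order.1 hlim).1 _ (by linarith)
  obtain ⟨T, hT⟩ := hev.exists
  refine ⟨T, ?_⟩
  have h1 : (weilQuadratic g).re ≤ ‖weilQuadratic g‖ :=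
    (le_abs_self _).trans (Complex.abs_re_le_norm _)
  have h2 := norm_weilZeroSidePartial_weilQuadratic_le hg T
  linarith

/-- The same for the form itself: `∀ ε > 0, ∃ T, Re Q(g) ≤ S_T(g) + ε`. -/
theorem exists_re_weilQuadratic_le_zeroSum_add (hg : IsWeilTest g) {ε : ℝ} (hε : 0 < ε) :
    ∃ T : ℝ, (weilQuadratic g).re ≤
      (∑ᶠ ρ ∈ weilZeroIndex T, (riemannZetaZeroOrder ρ : ℝ) * ‖weilMellin g ρ‖ ^ 2) + ε :=
  exists_le_zeroSum_add_of_le_re_weilQuadratic hg le_rfl hε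

end ZeroSide

/-! ## §2  Under RH the truncations sit below the form: `S_T(g) ≤ Re Q(g)` -/

section UnderRH

variable {g : ℝ → ℂ}

/-- Under RH every index of the truncated zero side lies on the critical line (it is a zero of `ζ`
with `Im ρ ≠ 0`, hence non-trivial and `≠ 1`). -/
theorem re_eq_half_of_mem (hRH : _root_.RiemannHypothesis) {T : ℝ} {ρ : ℂ}
    (h : ρ ∈ weilZeroIndex T) : ρ.re = 1 / 2 := by
  obtain ⟨hζ, -, -, him, -⟩ := h
  refine hRH ρ hζ ?_ ?_
  · rintro ⟨n, hn⟩
    rw [hn] at him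
    simp at him
  · rintro rfl
    simp at him

/-- Under RH the truncated zero side of `g ⋆ g̃` IS the truncated zero-side energy:
`Re Σ_{|Im ρ| ≤ T} m(ρ)(g ⋆ g̃)^(ρ) = S_T(g)` (on the line `(g ⋆ g̃)^(ρ) = ‖ĝ(ρ)‖²`,
`weilMellin_weilQuadratic_of_re_eq`). -/
theorem re_weilZeroSidePartial_eq_zeroSum (hRH : _root_.RiemannHypothesis) (hg : IsWeilTest g)
    (T : ℝ) :
    (weilZeroSidePartial (weilConv g (weilReflect g)) T).re =
      ∑ᶠ ρ ∈ weilZeroIndex T, (riemannZetaZeroOrder ρ : ℝ) * ‖weilMellin g ρ‖ ^ 2 := by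
  have hfin := weilZeroIndex_finite T
  unfold weilZeroSidePartial
  rw [finsum_mem_eq_finite_toFinset_sum _ hfin, finsum_mem_eq_finite_toFinset_sum _ hfin,
    Complex.re_sum]
  refine Finset.sum_congr rfl fun ρ hρ ↦ ?_
  have hmem := hfin.mem_toFinset.1 hρ
  rw [weilMellin_weilQuadratic_of_re_eq hg (re_eq_half_of_mem hRH hmem), ← Complex.ofReal_intCast,
    ← Complex.ofReal_mul, Complex.ofReal_re, Complex.normSq_eq_norm_sq]

/-- Under RH the truncated zero-side energies converge to `Re Q(g)` (explicit formula). -/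
theorem tendsto_zeroSum_of_riemannHypothesis (hRH : _root_.RiemannHypothesis)
    (hg : IsWeilTest g) :
    Tendsto (fun T : ℝ ↦
        ∑ᶠ ρ ∈ weilZeroIndex T, (riemannZetaZeroOrder ρ : ℝ) * ‖weilMellin g ρ‖ ^ 2)
      atTop (𝓝 (weilQuadratic g).re) := by
  have hk : IsWeilTest (weilConv g (weilReflect g)) := hg.weilConv hg.weilReflect
  have hlim : Tendsto (fun T ↦ (weilZeroSidePartial (weilConv g (weilReflect g)) T).re) atTop
      (𝓝 (weilQuadratic g).re) :=
    (Complex.continuous_re.tendsto _).comp (explicit_formula_holds hk)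
  exact hlim.congr fun T ↦ re_weilZeroSidePartial_eq_zeroSum hRH hg T

/-- **Under RH, `S_T(g) ≤ Re Q(g)` for every `T`** — a monotone family converging to `Re Q(g)`
stays below its limit.  This is the finite PINNING INEQUALITY of theory-2's file XII-w
(`MellinPinning.sum_zeroOrder_mul_norm_sq_weilMellin_le`) for the index sets `weilZeroIndex T`,
obtained here from `explicit_formula_holds` alone. -/
theorem zeroSum_le_re_weilQuadratic_of_riemannHypothesis (hRH : _root_.RiemannHypothesis)
    (hg : IsWeilTest g) (T : ℝ) :
    (∑ᶠ ρ ∈ weilZeroIndex T, (riemannZetaZeroOrder ρ : ℝ) * ‖weilMellin g ρ‖ ^ 2) ≤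
      (weilQuadratic g).re :=
  (zeroSum_mono g).ge_of_tendsto (tendsto_zeroSum_of_riemannHypothesis hRH hg) T

/-- **Under RH, `Re Q(g) = Z(g)`** in the junk-free form used by the domination laws:
`x ≤ Re Q(g) ↔ ∀ ε > 0, ∃ T, x ≤ S_T(g) + ε` (§1 gives `→` without RH; `←` is the pinning
inequality). -/
theorem le_re_weilQuadratic_iff_of_riemannHypothesis (hRH : _root_.RiemannHypothesis)
    (hg : IsWeilTest g) (x : ℝ) :
    x ≤ (weilQuadratic g).re ↔
      ∀ ε : ℝ, 0 < ε → ∃ T : ℝ, x ≤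
        (∑ᶠ ρ ∈ weilZeroIndex T, (riemannZetaZeroOrder ρ : ℝ) * ‖weilMellin g ρ‖ ^ 2) + ε := by
  refine ⟨fun hx ε hε ↦ exists_le_zeroSum_add_of_le_re_weilQuadratic hg hx hε, fun h ↦ ?_⟩
  refine le_of_forall_pos_le_add fun ε hε ↦ ?_
  obtain ⟨T, hT⟩ := h ε hε
  exact hT.trans (by linarith [zeroSum_le_re_weilQuadratic_of_riemannHypothesis hRH hg T])

end UnderRH

/-! ## §3  The status theorem: a window domination law is RH plus its zero-side form -/

section Status

variable {Φ : ℝ → (ℝ → ℂ) → ℝ} {lam₀ : ℝ}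

/-- **`DOM(Φ, λ₀) ⟹ RH` for every comparison functional `Φ ≥ 0`** (idea-1 g22's
`riemannHypothesis_of_prolateDomination`, generic): `DOM` gives `Re Q ≥ Φ ≥ 0` on the window
`[-log λ, log λ]` for every `λ ≥ λ₀`, these windows exhaust `(0, ∞)` (`WeilPositivityOn.mono`;
no sign condition on `λ₀` is needed: the window `log (max λ₀ e^a) ≥ a` serves `a`), and
`RH ↔ ∀ a > 0, WeilPositivityOn a` is the tree's Weil–Yoshida criterion.  The functional is idle
here: only its sign is used. -/
theorem riemannHypothesis_of_windowDomination
    (hΦ : ∀ lam : ℝ, lam₀ ≤ lam → ∀ g : ℝ → ℂ, IsWeilTest g →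
      tsupport g ⊆ Icc (-Real.log lam) (Real.log lam) → 0 ≤ Φ lam g)
    (hdom : ∀ lam : ℝ, lam₀ ≤ lam → ∀ g : ℝ → ℂ, IsWeilTest g →
      tsupport g ⊆ Icc (-Real.log lam) (Real.log lam) → Φ lam g ≤ (weilQuadratic g).re) :
    _root_.RiemannHypothesis := by
  refine riemannHypothesis_iff_forall_weilPositivityOn.2 fun a _ ↦ ?_
  set lam : ℝ := max lam₀ (Real.exp a) with hlam
  have hW : WeilPositivityOn (Real.log lam) := fun g hg hs ↦
    (hΦ lam (le_max_left _ _) g hg hs).trans (hdom lam (le_max_left _ _) g hg hs)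
  refine hW.mono ?_
  calc a = Real.log (Real.exp a) := (Real.log_exp a).symm
    _ ≤ Real.log lam := Real.log_le_log (Real.exp_pos a) (le_max_right _ _)

/-- **`DOM(Φ, λ₀) ⟹ DOM_Z(Φ, λ₀)`, with NO hypothesis on the zeros or on `Φ`**: whatever is
dominated by Weil's form is dominated by the zero-side energy (§1). -/
theorem zeroSideDomination_of_windowDomination
    (hdom : ∀ lam : ℝ, lam₀ ≤ lam → ∀ g : ℝ → ℂ, IsWeilTest g →
      tsupport g ⊆ Icc (-Real.log lam) (Real.log lam) → Φ lam g ≤ (weilQuadratic g).re) :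
    ∀ lam : ℝ, lam₀ ≤ lam → ∀ g : ℝ → ℂ, IsWeilTest g →
      tsupport g ⊆ Icc (-Real.log lam) (Real.log lam) → ∀ ε : ℝ, 0 < ε → ∃ T : ℝ,
        Φ lam g ≤
          (∑ᶠ ρ ∈ weilZeroIndex T, (riemannZetaZeroOrder ρ : ℝ) * ‖weilMellin g ρ‖ ^ 2) + ε :=
  fun lam hlam g hg hs _ hε ↦
    exists_le_zeroSum_add_of_le_re_weilQuadratic hg (hdom lam hlam g hg hs) hε

/-- **`RH ∧ DOM_Z(Φ, λ₀) ⟹ DOM(Φ, λ₀)`**: under RH the zero-side energy IS Weil's form (§2). -/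
theorem windowDomination_of_riemannHypothesis (hRH : _root_.RiemannHypothesis)
    (hZ : ∀ lam : ℝ, lam₀ ≤ lam → ∀ g : ℝ → ℂ, IsWeilTest g →
      tsupport g ⊆ Icc (-Real.log lam) (Real.log lam) → ∀ ε : ℝ, 0 < ε → ∃ T : ℝ,
        Φ lam g ≤
          (∑ᶠ ρ ∈ weilZeroIndex T, (riemannZetaZeroOrder ρ : ℝ) * ‖weilMellin g ρ‖ ^ 2) + ε) :
    ∀ lam : ℝ, lam₀ ≤ lam → ∀ g : ℝ → ℂ, IsWeilTest g →
      tsupport g ⊆ Icc (-Real.log lam) (Real.log lam) → Φ lam g ≤ (weilQuadratic g).re :=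
  fun lam hlam g hg hs ↦
    (le_re_weilQuadratic_iff_of_riemannHypothesis hRH hg (Φ lam g)).2 (hZ lam hlam g hg hs)

/-- ★ **THE STATUS OF A WINDOW DOMINATION LAW: `DOM(Φ, λ₀) ⟺ RH ∧ DOM_Z(Φ, λ₀)`** for every
comparison functional `Φ ≥ 0` on its windows and every threshold `λ₀`.  Applied to idea-1's
`Φ λ g = κ·λ^{-A}·L_λ(g)` (prolate leakage, `≥ 0`): **(PL) ⟺ RH ∧ (PL_Z)** with (PL_Z) the
RH-free law «zero-side energy dominates prolate leakage» — (PL)'s entire content beyond RH, and the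
object the cell's `κ*` sections and the dodger test actually probe.  [this track (theory-1 gen19),
HANDOFF-STATEMENT §J.34; idea-1 IDEAS-prolate §100] -/
theorem windowDomination_iff
    (hΦ : ∀ lam : ℝ, lam₀ ≤ lam → ∀ g : ℝ → ℂ, IsWeilTest g →
      tsupport g ⊆ Icc (-Real.log lam) (Real.log lam) → 0 ≤ Φ lam g) :
    (∀ lam : ℝ, lam₀ ≤ lam → ∀ g : ℝ → ℂ, IsWeilTest g →
        tsupport g ⊆ Icc (-Real.log lam) (Real.log lam) → Φ lam g ≤ (weilQuadratic g).re) ↔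
      _root_.RiemannHypothesis ∧
        ∀ lam : ℝ, lam₀ ≤ lam → ∀ g : ℝ → ℂ, IsWeilTest g →
          tsupport g ⊆ Icc (-Real.log lam) (Real.log lam) → ∀ ε : ℝ, 0 < ε → ∃ T : ℝ,
            Φ lam g ≤
              (∑ᶠ ρ ∈ weilZeroIndex T, (riemannZetaZeroOrder ρ : ℝ) * ‖weilMellin g ρ‖ ^ 2) + ε :=
  ⟨fun h ↦ ⟨riemannHypothesis_of_windowDomination hΦ h, zeroSideDomination_of_windowDomination h⟩,
    fun h ↦ windowDomination_of_riemannHypothesis h.1 h.2⟩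

/-- The same read contrapositively for route design: in a `¬RH` world EVERY window domination law
with `Φ ≥ 0` fails, however its zero-side form fares — no comparison functional rescues it. -/
theorem not_windowDomination_of_not_riemannHypothesis (hRH : ¬ _root_.RiemannHypothesis)
    (hΦ : ∀ lam : ℝ, lam₀ ≤ lam → ∀ g : ℝ → ℂ, IsWeilTest g →
      tsupport g ⊆ Icc (-Real.log lam) (Real.log lam) → 0 ≤ Φ lam g) :
    ¬ ∀ lam : ℝ, lam₀ ≤ lam → ∀ g : ℝ → ℂ, IsWeilTest g →
        tsupport g ⊆ Icc (-Real.log lam) (Real.log lam) → Φ lam g ≤ (weilQuadratic g).re :=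
  fun h ↦ hRH (riemannHypothesis_of_windowDomination hΦ h)

end Status

end Summit.RiemannHypothesis.RiemannHypothesis.Theorems.HandoffDomination

end
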